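import Mathlib
import Summits.ValiantsHypothesis.ValiantsHypothesis.Theorems.FifoMatchingNNNotVPSupportFnMatchings
import Summits.ValiantsHypothesis.ValiantsHypothesis.Theorems.FifoMatchingNNDivisionHardUnsaturatedTier
import Summits.ValiantsHypothesis.ValiantsHypothesis.Theorems.FifoMatchingStackQueueFormulaDivisionSeparation
import Summits.ValiantsHypothesis.ValiantsHypothesis.Theorems.DivisionGapPerDivisionHardStubJssContractionB
import Literature.Computability.AlgebraicComplexity.NestFreeMatchingPoly
import HarnessLib

/-!
# Route FifoMatching — crux `NNDivisionHard` (stmt-ValiantsHypothesis-21181):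
# CALIBRATION — the structural residual conjuncts hold for the noncrossing powers `NC_n^(D+1)`

Companion of `Theorems/FifoMatchingNNDivisionHardNoncrossingUndominated.lean` (✓ p824507: `NC_n^(D+1)` is
UNDOMINATED modulo every `T` with `|T| + 2 ≤ n`).  Here the remaining STRUCTURAL conjuncts of the residual of
record (`GrandResidual.nnDivisionHard_iff_grandResidual`, ✓ p823791) are certified for `h = NC_n^(D+1)`,
`NC_n = noncrossingMatchingPoly n ℝ≥0` the noncrossing (LIFO, monotone-cheap) matching polynomial:

* `exists_arcExponent_le_of_mem_support_pow` — every monomial of `NC_n^(D+1)` lies above the arc set of a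
  noncrossing perfect matching;
* `vertexDeg_of_mem_support_pow` — TORUS-HOMOGENEOUS: every monomial has vertex degree `D+1` at every vertex;
* `card_support_ge_of_mem_support_pow` — SPREAD: every monomial uses `≥ n` distinct arcs;
* `windowDense_of_mem_support_pow` — WINDOW-DENSE: every monomial meets every nonempty vertex window;
* `homogeneousComponent_pow_eq_zero` — DEEP: `NC_n^(D+1)` is homogeneous of degree `n(D+1)`, so all other
  homogeneous components vanish;
* `complexity_noncrossingPow_le` — CHEAP: `L₊(NC_n^(2^t)) ≤ 4(2n+1)³ + t` (tree: `StackQueue.complexity_noncrossingMatchingPoly_le`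
  and repeated squaring, `JssContraction.complexity_mul_self_le`).

So (reading, the quasi-polynomial bookkeeping of «cheap»/«deep» thresholds left to the reader): with
`t = (log₂ n + k)^k`, `h = NC_n^(2^t)` is an EXPLICIT MEMBER of the residual enemy class of 21181 — the
class is not vacuous, and the Boolean-shadow domination rungs provably do not reach it.  Nothing here bears
on the truth of 21181; `NNDivisionHard`, `NNNotVP` and `VP ≠ VNP` stay OPEN.  No definitions, no named facts.
-/

noncomputable section

-- Sub = Summit single-conjunct layout: the duplicated namespace component is mandated by the tree.
set_option linter.dupNamespace false
set_option autoImplicit false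

namespace Summit.ValiantsHypothesis.ValiantsHypothesis.Theorems.FifoMatching.NNDivisionHard.NoncrossingResidualMember

open MvPolynomial Finset Literature.Computability.AlgebraicComplexity
open scoped NNReal BigOperators Classical
open Summit.ValiantsHypothesis.ValiantsHypothesis.Theorems.FifoMatching.NNNotVP.DivisionSplit
  (σ mem_support_arcExponent)
open Summit.ValiantsHypothesis.ValiantsHypothesis.Theorems.FifoMatching.NNLowDegreeCofactorHard (vertexDeg)
open Summit.ValiantsHypothesis.ValiantsHypothesis.Theorems.FifoMatching.NNDivisionHard.UnsaturatedTier
  (vertexDeg_eq_sum)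

variable {n : ℕ}

/-! ### §1 Monomials of `NC_n^(D+1)` lie above noncrossing perfect matchings -/

/-- Every monomial of `NC_n^(D+1)` dominates the arc exponent of some noncrossing perfect matching.
[folklore] -/
theorem exists_arcExponent_le_of_mem_support_pow (D : ℕ) {d : σ n →₀ ℕ}
    (hd : d ∈ ((noncrossingMatchingPoly n ℝ≥0) ^ (D + 1)).support) :
    ∃ N ∈ noncrossingMatchings (2 * n), arcExponent N ≤ d := by
  induction D generalizing d with
  | zero =>
    rw [zero_add, pow_one, support_noncrossingMatchingPoly, Finset.mem_image] at hd
    obtain ⟨N, hN, rfl⟩ := hd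
    exact ⟨N, hN, le_rfl⟩
  | succ D ih =>
    rw [pow_succ] at hd
    have h := MvPolynomial.support_mul _ _ hd
    rw [Finset.mem_add] at h
    obtain ⟨a, ha, b, _, rfl⟩ := h
    obtain ⟨N, hN, hNa⟩ := ih ha
    exact ⟨N, hN, hNa.trans (self_le_add_right a b)⟩

/-! ### §2 Vertex degrees: torus-homogeneity -/

/-- `vertexDeg` is additive. [folklore] -/
theorem vertexDeg_add {m : ℕ} (a b : (Fin m × Fin m) →₀ ℕ) (v : Fin m) :
    vertexDeg (a + b) v = vertexDeg a v + vertexDeg b v := by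
  rw [vertexDeg_eq_sum, vertexDeg_eq_sum, vertexDeg_eq_sum, ← Finset.sum_add_distrib]
  refine Finset.sum_congr rfl fun j _ => ?_
  simp only [Finsupp.add_apply]
  ring

/-- The arc exponent of a perfect matching has vertex degree `1` everywhere. [folklore] -/
theorem vertexDeg_arcExponent {m : ℕ} {N : Fin m → Fin m} (hN : N ∈ perfectMatchings m) (v : Fin m) :
    vertexDeg (arcExponent N) v = 1 := by
  obtain ⟨hinv, hfpf⟩ := mem_perfectMatchings.1 hN
  rw [vertexDeg_eq_sum, Finset.sum_add_distrib]
  have h1 : ∑ j : Fin m, arcExponent N (v, j) = if v < N v then 1 else 0 := by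
    have : ∀ j : Fin m, arcExponent N (v, j) = if j = N v then (if v < N v then 1 else 0) else 0 := by
      intro j
      rw [arcExponent_apply]
      by_cases hj : j = N v
      · subst hj
        by_cases hv : v < N v
        · rw [if_pos ⟨hv, rfl⟩, if_pos rfl, if_pos hv]
        · rw [if_neg (fun h => hv h.1), if_pos rfl, if_neg hv]
      · rw [if_neg (fun h => hj h.2.symm), if_neg hj]
    simp_rw [this]
    rw [Finset.sum_ite_eq' Finset.univ (N v)]
    simp
  have h2 : ∑ j : Fin m, arcExponent N (j, v) = if N v < v then 1 else 0 := by
    have : ∀ j : Fin m, arcExponent N (j, v) = if j = N v then (if N v < v then 1 else 0) else 0 := by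
      intro j
      rw [arcExponent_apply]
      by_cases hj : j = N v
      · subst hj
        rw [hinv]
        by_cases hv : N v < v
        · rw [if_pos ⟨hv, rfl⟩, if_pos rfl, if_pos hv]
        · rw [if_neg (fun h => hv h.1), if_pos rfl, if_neg hv]
      · have hne : ¬ (j < N j ∧ N j = v) := by
          rintro ⟨-, h⟩
          apply hj
          rw [← h, hinv]
        rw [if_neg hne, if_neg hj]
    simp_rw [this]
    rw [Finset.sum_ite_eq' Finset.univ (N v)]
    simp
  rw [h1, h2]
  rcases lt_trichotomy v (N v) with h | h | h
  · rw [if_pos h, if_neg (not_lt.2 h.le)]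
  · exact absurd h.symm (hfpf v)
  · rw [if_neg (not_lt.2 h.le), if_pos h]

/-- **TORUS-HOMOGENEITY**: every monomial of `NC_n^(D+1)` has vertex degree `D + 1` at every vertex.
[folklore] -/
theorem vertexDeg_of_mem_support_pow (D : ℕ) {d : σ n →₀ ℕ}
    (hd : d ∈ ((noncrossingMatchingPoly n ℝ≥0) ^ (D + 1)).support) (v : Fin (2 * n)) :
    vertexDeg d v = D + 1 := by
  induction D generalizing d with
  | zero =>
    rw [zero_add, pow_one, support_noncrossingMatchingPoly, Finset.mem_image] at hd
    obtain ⟨N, hN, rfl⟩ := hd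
    exact vertexDeg_arcExponent (noncrossingMatchings_subset_perfectMatchings hN) v
  | succ D ih =>
    rw [pow_succ] at hd
    have h := MvPolynomial.support_mul _ _ hd
    rw [Finset.mem_add] at h
    obtain ⟨a, ha, b, hb, rfl⟩ := h
    rw [support_noncrossingMatchingPoly, Finset.mem_image] at hb
    obtain ⟨N, hN, rfl⟩ := hb
    rw [vertexDeg_add, ih ha, vertexDeg_arcExponent (noncrossingMatchings_subset_perfectMatchings hN) v]

/-- Hence all monomials of `NC_n^(D+1)` share one vertex-degree vector (the residual's TORUS conjunct).
[folklore] -/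
theorem torus_noncrossingPow (D : ℕ) :
    ∀ d ∈ ((noncrossingMatchingPoly n ℝ≥0) ^ (D + 1)).support,
      ∀ d' ∈ ((noncrossingMatchingPoly n ℝ≥0) ^ (D + 1)).support, vertexDeg d = vertexDeg d' := by
  intro d hd d' hd'
  funext v
  rw [vertexDeg_of_mem_support_pow D hd v, vertexDeg_of_mem_support_pow D hd' v]

/-! ### §3 Spread and window-density -/

/-- The arc set of a perfect matching of `[2n]` has exactly `n` arcs. [folklore] -/
theorem card_support_arcExponent {N : Fin (2 * n) → Fin (2 * n)} (hN : N ∈ perfectMatchings (2 * n)) :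
    (arcExponent N).support.card = n := by
  have hset : (arcExponent N).support = (openers N).image fun i => (i, N i) := by
    ext e
    rw [mem_support_arcExponent, Finset.mem_image]
    constructor
    · rintro ⟨h1, h2⟩
      exact ⟨e.1, mem_openers.2 h1, Prod.ext rfl h2⟩
    · rintro ⟨i, hi, rfl⟩
      exact ⟨mem_openers.1 hi, rfl⟩
  rw [hset, Finset.card_image_of_injective _ (fun i j hij => (Prod.mk.inj hij).1)]
  exact card_openers hN

/-- **SPREAD**: every monomial of `NC_n^(D+1)` uses at least `n` distinct arcs. [folklore] -/
theorem card_support_ge_of_mem_support_pow (D : ℕ) {d : σ n →₀ ℕ}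
    (hd : d ∈ ((noncrossingMatchingPoly n ℝ≥0) ^ (D + 1)).support) : n ≤ d.support.card := by
  obtain ⟨N, hN, hle⟩ := exists_arcExponent_le_of_mem_support_pow D hd
  calc n = (arcExponent N).support.card :=
        (card_support_arcExponent (noncrossingMatchings_subset_perfectMatchings hN)).symm
    _ ≤ d.support.card := Finset.card_le_card (Finsupp.support_mono hle)

/-- **WINDOW-DENSITY**: every monomial of `NC_n^(D+1)` meets every NONEMPTY window `[s, s + G)` of vertices
(indeed it covers every vertex). [folklore] -/
theorem windowDense_of_mem_support_pow (D : ℕ) {d : σ n →₀ ℕ}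
    (hd : d ∈ ((noncrossingMatchingPoly n ℝ≥0) ^ (D + 1)).support) (s G : ℕ) (hG : 1 ≤ G)
    (hs : s + G ≤ 2 * n) :
    ∃ e ∈ d.support, (s ≤ e.1.val ∧ e.1.val < s + G) ∨ (s ≤ e.2.val ∧ e.2.val < s + G) := by
  obtain ⟨N, hN, hle⟩ := exists_arcExponent_le_of_mem_support_pow D hd
  obtain ⟨hinv, hfpf⟩ := mem_perfectMatchings.1 (noncrossingMatchings_subset_perfectMatchings hN)
  have hsub : (arcExponent N).support ⊆ d.support := Finsupp.support_mono hle
  let v : Fin (2 * n) := ⟨s, by omega⟩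
  rcases lt_or_gt_of_ne (hfpf v) with hlt | hgt
  · -- `N v < v`: the arc `(N v, v)`
    refine ⟨(N v, v), hsub ((mem_support_arcExponent N _).2 ⟨by rw [hinv]; exact hlt, hinv v⟩), Or.inr ?_⟩
    simp only [v]
    omega
  · -- `v < N v`: the arc `(v, N v)`
    refine ⟨(v, N v), hsub ((mem_support_arcExponent N _).2 ⟨hgt, rfl⟩), Or.inl ?_⟩
    simp only [v]
    omega

/-! ### §4 Depth and cheapness -/

/-- **DEEP**: `NC_n^(D+1)` is homogeneous of degree `n(D+1)`; every other homogeneous component vanishes.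
[folklore] -/
theorem homogeneousComponent_pow_eq_zero (D e : ℕ) (he : e ≠ n * (D + 1)) :
    homogeneousComponent e ((noncrossingMatchingPoly n ℝ≥0) ^ (D + 1)) = 0 := by
  have hhom : ((noncrossingMatchingPoly n ℝ≥0) ^ (D + 1)).IsHomogeneous (n * (D + 1)) :=
    (noncrossingMatchingPoly_isHomogeneous n (k := ℝ≥0)).pow (D + 1)
  rw [homogeneousComponent_of_mem hhom, if_neg he]

/-- **CHEAP**: `L₊(NC_n^(2^t)) ≤ 4(2n+1)³ + t` by repeated squaring of the stack polynomial's interval-DP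
circuit (`StackQueue.complexity_noncrossingMatchingPoly_le`). [folklore] -/
theorem complexity_noncrossingPow_le (n t : ℕ) :
    complexity ((noncrossingMatchingPoly n ℝ≥0) ^ (2 ^ t)) ≤ 4 * (2 * n + 1) ^ 3 + t := by
  induction t with
  | zero => simpa using StackQueue.complexity_noncrossingMatchingPoly_le (k := ℝ≥0) n
  | succ t ih =>
    rw [pow_succ, pow_mul, sq]
    calc complexity ((noncrossingMatchingPoly n ℝ≥0) ^ 2 ^ t * (noncrossingMatchingPoly n ℝ≥0) ^ 2 ^ t)
        ≤ complexity ((noncrossingMatchingPoly n ℝ≥0) ^ 2 ^ t) + 1 :=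
          Summit.ValiantsHypothesis.ValiantsHypothesis.Theorems.DivisionGapPerDivisionHard.JssContraction.complexity_mul_self_le _
      _ ≤ 4 * (2 * n + 1) ^ 3 + t + 1 := by omega

end Summit.ValiantsHypothesis.ValiantsHypothesis.Theorems.FifoMatching.NNDivisionHard.NoncrossingResidualMember

end
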